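import Summits.BirchSwinnertonDyer.Rank1Residual.X11b.ChaPairs1
import HarnessLib

/-!
# BSD rank-≤1 residual cell, class X11b: `BSD(E,5)` from PUBLISHED theorems + a two-engine Heegner-index
# certificate for the Cha-certified RESISTANT pairs of X11 ∧ r = 1 ∧ ¬sst ∧ p ≥ 5 (part 3 of 3)

HONEST FRAMING (cell `b2b-bsdres-*`, verbatim): prove what is provable now; shrink each hard class
to its core with data; no claim beyond stated classes; COMBINATION classes deleted from PUBLISHED
theorems only, CONSTRUCTION-shaped remainder typed; this is not "finishing BSD". Class X11b stays
CONSTRUCTION-SHAPED; everything here is PER PAIR; no lane verdict is changed; no named fact.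

Unit `b2b-bsdres-x11c`, gen 3. The RESISTANT list of the unit's `p`-adic certificate route
(HOME/b2b-bsdres-x11c/REPORT.md §4: 64 pairs at `p = 5` with `ρ̄_{E,5}` irreducible NOT surjective
— Sutherland `5S4` ×52, `5Ns` ×12 — and no (ram) witness, `N < 5·10⁵`, plus `403280bd1@5` with
`#Ш_an = 25`) is attacked with the PUBLISHED per-curve theorem that needs neither surjectivity nor
(ram): Cha 2005 (tree fact `Cha2005.thm52_padicValNat_shaOrder_le`, as printed by Miller 2011
Thm. 5.2 / GJPST 2009 Thm. 3.5, flag `Cha05-primary-unread`; its reduction hypothesis `p² ∤ N`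
allows `p ∥ N`). The route file `X11b/ChaRoute.lean` shows that on the cell's class X11b every
Galois / reduction hypothesis of Cha's theorem is automatic. Here, for each of the 24 pairs with
`5 ∤ ∏ c_q` (8 per part, by increasing conductor):

* the theorem `bsdp_c<label>`: for `W =` Cremona's model (literal a-invariants; NO instance
  hypothesis — `Δ ≠ 0` and global minimality are decided in the kernel, the latter by
  `isGloballyMinimal_of_krausCriterion_bounded₂`), the published binders `hCha`, `hGZK`, the Heegner
  datum (`K` imaginary quadratic with the Heegner hypothesis for the level `N` and `5 ∤ d_K`,
  `5² ∤ N`, a Heegner point `P` of infinite order, `5 ∤ [E(K) : ℤ P]`), `r_an(E) ≤ 1` and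
  `#Ш_an = q` with `ord₅ q = 0` give Miller's `BSDp W 5`; multiplicative reduction at `5`
  (`5 ∣ Δ`, `5 ∤ c₄`) and irreducibility of `E[5]` (Frobenius witness `ℓ`, kernel point count of
  `ChaPairsCards.lean`, root-freeness mod `5`) are KERNEL facts (`decide`), through the generic
  `bsdp_of_ainvs_of_chaCertificate` (part 1, §1).

The numbers left as binders are exactly what the lane certifies by two engines: `r_an = 1`,
`#Ш_an = 1`, and the Heegner-index certificate — engine 1 (cypari2 = X9 gen 7 `jobD1b.py`
verbatim; jobs j077792, j077793): Miller 2011 Thm. 4.1 / Cor. 4.8 normalisation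
`ĥ(y_K) = L'(E,1)·L(E^D,1)·√|D| / (4·Area)`, `ρ = ĥ(y_K)/ĥ(x)`, `m = √(4ρ) ∈ ℤ`, `ord₅ m = 0`
for the field `K = ℚ(√D)` named in each docstring; engine 2 (stdlib python = X9 gen 7 `eng2`
verbatim; jobs j077948–j077959). For the 40 resistant pairs with `5 ∣ c_q` for some `q` every
Heegner field gives `5 ∣ m` (97 `BOUND` rows, jobs j077797/j077800), as Gross–Zagier + BSD over `K`
predict (`[E(K) : ℤ y_K] = c·∏c_q·#Ш(E/K)^{1/2}` up to `2`-powers): those pairs stay RESISTANT with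
that named failing hypothesis (REPORT §11). Labels certified here (part 3): `208080ct1`, `259920bd1`, `283220v1`, `296240bf1`, `304560s1`, `353440i1`, `389205h1`, `392040q1`.

References: B. Cha, J. Number Theory 111 (2005) [Cha2005]; R. L. Miller, LMS JCM 14 (2011) Thm. 5.2,
Thm. 4.1, Cor. 4.8 [Miller2011LMS]; GJPST, Math. Comp. 78 (2009) Thm. 3.5 [GrigorovJorzaPatrikisSteinTarnita2009];
B. Mazur, Invent. Math. 44 (1978) Prop. 6.3 (1) [Mazur1978]; J. H. Silverman, *AEC* (2009) VII.1,
VII.5 [SilvermanAEC2009]; A. Kraus, Acta Arith. 54 (1989) [Kraus1989]; Cremona's tables [Cremona2006].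
-/

set_option linter.dupNamespace false
set_option autoImplicit false

noncomputable section

open scoped Classical

open WeierstrassCurve Literature.NumberTheory.EllipticCurves
  Literature.NumberTheory.EllipticCurves.Rank1Residual
  Literature.NumberTheory.EllipticCurves.Rank1Residual.X11RankOneCertificates
  Literature.NumberTheory.EllipticCurves.Cha2005
  Summit.BirchSwinnertonDyer.BirchSwinnertonDyer.Rank1Residual.IntModel
  Summit.BirchSwinnertonDyer.BirchSwinnertonDyer.Rank1Residual.X11RankOne

namespace Summit.BirchSwinnertonDyer.Rank1Residual.X11b

/-! ### §4. Pairs `208080ct1`, `259920bd1`, `283220v1`, `296240bf1`, `304560s1`, `353440i1`, `389205h1`, `392040q1` -/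

/-- **`BSD(E,5)` for `208080ct1`** (`N = 208080 = 2^4·3^2·5·17^2`; `ρ̄_{E,5}` image `5S4`, `nonsplit` multiplicative at `5`, additive at
`2`, `3`, `17`, `∏ c_q = 4`) from Cha 2005 + GZK and the Heegner-index certificate. Kernel: `Δ ≠ 0`, global
minimality (§2 of `ChaPairsMinimality`), `5 ∣ Δ ∧ 5 ∤ c₄`, `E[5]` irreducible (`ℓ = 11`, `#Ẽ(𝔽_11) = 11`,
`a_11 = 1`). Numbers (binders): `r_an ≤ 1`, `#Ш_an` a `5`-adic unit, the Heegner datum with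
`5 ∤ [E(K) : ℤ y_K]` — two-engine certificate of unit `b2b-bsdres-x11c` gen 3: `K = ℚ(√-191)`,
`m = √(4ρ) = 8`, `ord₅ m = 0` (engine 1 cypari2 jobs j077792/j077793; engine 2 stdlib).
[cite: Miller2011LMS, Thm. 5.2 and Def. 1.1] [cite: Cremona2006, Table 1 (Cremona label 208080ct1)] -/
theorem bsdp_c208080ct1 (hCha : thm52_padicValNat_shaOrder_le)
    (hGZK : rank_eq_analyticRank_of_analyticRank_le_one)
    (W : WeierstrassCurve ℚ) (hW : W = ⟨0, 0, 0, -2448, -42228⟩)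
    {N : ℕ} [NeZero N] {K : Type} [Field K] [NumberField K] (hK : IsImaginaryQuadratic K)
    (hH : SatisfiesHeegnerHypothesis N K) {P : (W.baseChange K).toAffine.Point}
    (hP : IsHeegnerPoint N W K P) (hnt : ¬ IsOfFinAddOrder P)
    (hpD : ¬ (5 : ℤ) ∣ NumberField.discr K) (hpN : ¬ 5 ^ 2 ∣ N)
    (hI : ¬ 5 ∣ (AddSubgroup.zmultiples P).index)
    (hr : W.analyticRank ≤ 1) {q : ℚ} (hq : shaAn W = (q : ℂ)) (hv : padicValRat 5 q = 0) :
    BSDp W 5 := by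
  subst hW
  haveI := isElliptic_of_discOf_ne_zero 0 0 0 (-2448) (-42228) (by decide +kernel)
  haveI := isGloballyMinimal_of_krausCriterion_bounded₂ 0 0 0 (-2448) (-42228) (by decide +kernel) (by decide +kernel)
    (by decide +kernel)
  haveI : Fact (Nat.Prime 5) := ⟨by norm_num⟩
  haveI : Fact (Nat.Prime 11) := ⟨by norm_num⟩
  exact bsdp_of_ainvs_of_chaCertificate hCha hGZK 0 0 0 (-2448) (-42228) (integralModelInt_eq_of_map_eq _ (map_mk_int _ _ _ _ _))
    5 11 11 (by decide) (by decide +kernel) (by decide +kernel) (by decide) (by decide +kernel) card_c208080ct1_11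
    (by decide +kernel) hK hH hP hnt (mod_cast hpD) hpN hI hr hq hv

/-- **`BSD(E,5)` for `259920bd1`** (`N = 259920 = 2^4·3^2·5·19^2`; `ρ̄_{E,5}` image `5S4`, `nonsplit` multiplicative at `5`, additive at
`2`, `3`, `19`, `∏ c_q = 2`) from Cha 2005 + GZK and the Heegner-index certificate. Kernel: `Δ ≠ 0`, global
minimality (§2 of `ChaPairsMinimality`), `5 ∣ Δ ∧ 5 ∤ c₄`, `E[5]` irreducible (`ℓ = 11`, `#Ẽ(𝔽_11) = 6`,
`a_11 = 6`). Numbers (binders): `r_an ≤ 1`, `#Ш_an` a `5`-adic unit, the Heegner datum with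
`5 ∤ [E(K) : ℤ y_K]` — two-engine certificate of unit `b2b-bsdres-x11c` gen 3: `K = ℚ(√-431)`,
`m = √(4ρ) = 44`, `ord₅ m = 0` (engine 1 cypari2 jobs j077792/j077793; engine 2 stdlib).
[cite: Miller2011LMS, Thm. 5.2 and Def. 1.1] [cite: Cremona2006, Table 1 (Cremona label 259920bd1)] -/
theorem bsdp_c259920bd1 (hCha : thm52_padicValNat_shaOrder_le)
    (hGZK : rank_eq_analyticRank_of_analyticRank_le_one)
    (W : WeierstrassCurve ℚ) (hW : W = ⟨0, 0, 0, 3518667, -2741041593⟩)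
    {N : ℕ} [NeZero N] {K : Type} [Field K] [NumberField K] (hK : IsImaginaryQuadratic K)
    (hH : SatisfiesHeegnerHypothesis N K) {P : (W.baseChange K).toAffine.Point}
    (hP : IsHeegnerPoint N W K P) (hnt : ¬ IsOfFinAddOrder P)
    (hpD : ¬ (5 : ℤ) ∣ NumberField.discr K) (hpN : ¬ 5 ^ 2 ∣ N)
    (hI : ¬ 5 ∣ (AddSubgroup.zmultiples P).index)
    (hr : W.analyticRank ≤ 1) {q : ℚ} (hq : shaAn W = (q : ℂ)) (hv : padicValRat 5 q = 0) :
    BSDp W 5 := by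
  subst hW
  haveI := isElliptic_of_discOf_ne_zero 0 0 0 3518667 (-2741041593) (by decide +kernel)
  haveI := isGloballyMinimal_of_krausCriterion_bounded₂ 0 0 0 3518667 (-2741041593) (by decide +kernel) (by decide +kernel)
    (by decide +kernel)
  haveI : Fact (Nat.Prime 5) := ⟨by norm_num⟩
  haveI : Fact (Nat.Prime 11) := ⟨by norm_num⟩
  exact bsdp_of_ainvs_of_chaCertificate hCha hGZK 0 0 0 3518667 (-2741041593) (integralModelInt_eq_of_map_eq _ (map_mk_int _ _ _ _ _))
    5 11 6 (by decide) (by decide +kernel) (by decide +kernel) (by decide) (by decide +kernel) card_c259920bd1_11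
    (by decide +kernel) hK hH hP hnt (mod_cast hpD) hpN hI hr hq hv

/-- **`BSD(E,5)` for `283220v1`** (`N = 283220 = 2^2·5·7^2·17^2`; `ρ̄_{E,5}` image `5S4`, `nonsplit` multiplicative at `5`, additive at
`2`, `7`, `17`, `∏ c_q = 6`) from Cha 2005 + GZK and the Heegner-index certificate. Kernel: `Δ ≠ 0`, global
minimality (§2 of `ChaPairsMinimality`), `5 ∣ Δ ∧ 5 ∤ c₄`, `E[5]` irreducible (`ℓ = 3`, `#Ẽ(𝔽_3) = 4`,
`a_3 = 0`). Numbers (binders): `r_an ≤ 1`, `#Ш_an` a `5`-adic unit, the Heegner datum with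
`5 ∤ [E(K) : ℤ y_K]` — two-engine certificate of unit `b2b-bsdres-x11c` gen 3: `K = ℚ(√-271)`,
`m = √(4ρ) = 72`, `ord₅ m = 0` (engine 1 cypari2 jobs j077792/j077793; engine 2 stdlib).
[cite: Miller2011LMS, Thm. 5.2 and Def. 1.1] [cite: Cremona2006, Table 1 (Cremona label 283220v1)] -/
theorem bsdp_c283220v1 (hCha : thm52_padicValNat_shaOrder_le)
    (hGZK : rank_eq_analyticRank_of_analyticRank_le_one)
    (W : WeierstrassCurve ℚ) (hW : W = ⟨0, 0, 0, -13328, 536452⟩)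
    {N : ℕ} [NeZero N] {K : Type} [Field K] [NumberField K] (hK : IsImaginaryQuadratic K)
    (hH : SatisfiesHeegnerHypothesis N K) {P : (W.baseChange K).toAffine.Point}
    (hP : IsHeegnerPoint N W K P) (hnt : ¬ IsOfFinAddOrder P)
    (hpD : ¬ (5 : ℤ) ∣ NumberField.discr K) (hpN : ¬ 5 ^ 2 ∣ N)
    (hI : ¬ 5 ∣ (AddSubgroup.zmultiples P).index)
    (hr : W.analyticRank ≤ 1) {q : ℚ} (hq : shaAn W = (q : ℂ)) (hv : padicValRat 5 q = 0) :
    BSDp W 5 := by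
  subst hW
  haveI := isElliptic_of_discOf_ne_zero 0 0 0 (-13328) 536452 (by decide +kernel)
  haveI := isGloballyMinimal_of_krausCriterion_bounded₂ 0 0 0 (-13328) 536452 (by decide +kernel) (by decide +kernel)
    (by decide +kernel)
  haveI : Fact (Nat.Prime 5) := ⟨by norm_num⟩
  haveI : Fact (Nat.Prime 3) := ⟨by norm_num⟩
  exact bsdp_of_ainvs_of_chaCertificate hCha hGZK 0 0 0 (-13328) 536452 (integralModelInt_eq_of_map_eq _ (map_mk_int _ _ _ _ _))
    5 3 4 (by decide) (by decide +kernel) (by decide +kernel) (by decide) (by decide +kernel) card_c283220v1_3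
    (by decide +kernel) hK hH hP hnt (mod_cast hpD) hpN hI hr hq hv

/-- **`BSD(E,5)` for `296240bf1`** (`N = 296240 = 2^4·5·7·23^2`; `ρ̄_{E,5}` image `5S4`, `nonsplit` multiplicative at `5`, additive at
`2`, `23`, `∏ c_q = 2`) from Cha 2005 + GZK and the Heegner-index certificate. Kernel: `Δ ≠ 0`, global
minimality (§2 of `ChaPairsMinimality`), `5 ∣ Δ ∧ 5 ∤ c₄`, `E[5]` irreducible (`ℓ = 3`, `#Ẽ(𝔽_3) = 4`,
`a_3 = 0`). Numbers (binders): `r_an ≤ 1`, `#Ш_an` a `5`-adic unit, the Heegner datum with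
`5 ∤ [E(K) : ℤ y_K]` — two-engine certificate of unit `b2b-bsdres-x11c` gen 3: `K = ℚ(√-111)`,
`m = √(4ρ) = 8`, `ord₅ m = 0` (engine 1 cypari2 jobs j077792/j077793; engine 2 stdlib).
[cite: Miller2011LMS, Thm. 5.2 and Def. 1.1] [cite: Cremona2006, Table 1 (Cremona label 296240bf1)] -/
theorem bsdp_c296240bf1 (hCha : thm52_padicValNat_shaOrder_le)
    (hGZK : rank_eq_analyticRank_of_analyticRank_le_one)
    (W : WeierstrassCurve ℚ) (hW : W = ⟨0, 0, 0, -28888, 1894188⟩)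
    {N : ℕ} [NeZero N] {K : Type} [Field K] [NumberField K] (hK : IsImaginaryQuadratic K)
    (hH : SatisfiesHeegnerHypothesis N K) {P : (W.baseChange K).toAffine.Point}
    (hP : IsHeegnerPoint N W K P) (hnt : ¬ IsOfFinAddOrder P)
    (hpD : ¬ (5 : ℤ) ∣ NumberField.discr K) (hpN : ¬ 5 ^ 2 ∣ N)
    (hI : ¬ 5 ∣ (AddSubgroup.zmultiples P).index)
    (hr : W.analyticRank ≤ 1) {q : ℚ} (hq : shaAn W = (q : ℂ)) (hv : padicValRat 5 q = 0) :
    BSDp W 5 := by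
  subst hW
  haveI := isElliptic_of_discOf_ne_zero 0 0 0 (-28888) 1894188 (by decide +kernel)
  haveI := isGloballyMinimal_of_krausCriterion_bounded₂ 0 0 0 (-28888) 1894188 (by decide +kernel) (by decide +kernel)
    (by decide +kernel)
  haveI : Fact (Nat.Prime 5) := ⟨by norm_num⟩
  haveI : Fact (Nat.Prime 3) := ⟨by norm_num⟩
  exact bsdp_of_ainvs_of_chaCertificate hCha hGZK 0 0 0 (-28888) 1894188 (integralModelInt_eq_of_map_eq _ (map_mk_int _ _ _ _ _))
    5 3 4 (by decide) (by decide +kernel) (by decide +kernel) (by decide) (by decide +kernel) card_c296240bf1_3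
    (by decide +kernel) hK hH hP hnt (mod_cast hpD) hpN hI hr hq hv

/-- **`BSD(E,5)` for `304560s1`** (`N = 304560 = 2^4·3^4·5·47`; `ρ̄_{E,5}` image `5S4`, `nonsplit` multiplicative at `5`, additive at
`2`, `3`, `∏ c_q = 2`) from Cha 2005 + GZK and the Heegner-index certificate. Kernel: `Δ ≠ 0`, global
minimality (§2 of `ChaPairsMinimality`), `5 ∣ Δ ∧ 5 ∤ c₄`, `E[5]` irreducible (`ℓ = 7`, `#Ẽ(𝔽_7) = 8`,
`a_7 = 0`). Numbers (binders): `r_an ≤ 1`, `#Ш_an` a `5`-adic unit, the Heegner datum with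
`5 ∤ [E(K) : ℤ y_K]` — two-engine certificate of unit `b2b-bsdres-x11c` gen 3: `K = ℚ(√-311)`,
`m = √(4ρ) = 8`, `ord₅ m = 0` (engine 1 cypari2 jobs j077792/j077793; engine 2 stdlib).
[cite: Miller2011LMS, Thm. 5.2 and Def. 1.1] [cite: Cremona2006, Table 1 (Cremona label 304560s1)] -/
theorem bsdp_c304560s1 (hCha : thm52_padicValNat_shaOrder_le)
    (hGZK : rank_eq_analyticRank_of_analyticRank_le_one)
    (W : WeierstrassCurve ℚ) (hW : W = ⟨0, 0, 0, -108783, -475290018⟩)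
    {N : ℕ} [NeZero N] {K : Type} [Field K] [NumberField K] (hK : IsImaginaryQuadratic K)
    (hH : SatisfiesHeegnerHypothesis N K) {P : (W.baseChange K).toAffine.Point}
    (hP : IsHeegnerPoint N W K P) (hnt : ¬ IsOfFinAddOrder P)
    (hpD : ¬ (5 : ℤ) ∣ NumberField.discr K) (hpN : ¬ 5 ^ 2 ∣ N)
    (hI : ¬ 5 ∣ (AddSubgroup.zmultiples P).index)
    (hr : W.analyticRank ≤ 1) {q : ℚ} (hq : shaAn W = (q : ℂ)) (hv : padicValRat 5 q = 0) :
    BSDp W 5 := by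
  subst hW
  haveI := isElliptic_of_discOf_ne_zero 0 0 0 (-108783) (-475290018) (by decide +kernel)
  haveI := isGloballyMinimal_of_krausCriterion_bounded₂ 0 0 0 (-108783) (-475290018) (by decide +kernel) (by decide +kernel)
    (by decide +kernel)
  haveI : Fact (Nat.Prime 5) := ⟨by norm_num⟩
  haveI : Fact (Nat.Prime 7) := ⟨by norm_num⟩
  exact bsdp_of_ainvs_of_chaCertificate hCha hGZK 0 0 0 (-108783) (-475290018) (integralModelInt_eq_of_map_eq _ (map_mk_int _ _ _ _ _))
    5 7 8 (by decide) (by decide +kernel) (by decide +kernel) (by decide) (by decide +kernel) card_c304560s1_7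
    (by decide +kernel) hK hH hP hnt (mod_cast hpD) hpN hI hr hq hv

/-- **`BSD(E,5)` for `353440i1`** (`N = 353440 = 2^5·5·47^2`; `ρ̄_{E,5}` image `5S4`, `nonsplit` multiplicative at `5`, additive at
`2`, `47`, `∏ c_q = 6`) from Cha 2005 + GZK and the Heegner-index certificate. Kernel: `Δ ≠ 0`, global
minimality (§2 of `ChaPairsMinimality`), `5 ∣ Δ ∧ 5 ∤ c₄`, `E[5]` irreducible (`ℓ = 3`, `#Ẽ(𝔽_3) = 4`,
`a_3 = 0`). Numbers (binders): `r_an ≤ 1`, `#Ш_an` a `5`-adic unit, the Heegner datum with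
`5 ∤ [E(K) : ℤ y_K]` — two-engine certificate of unit `b2b-bsdres-x11c` gen 3: `K = ℚ(√-31)`,
`m = √(4ρ) = 24`, `ord₅ m = 0` (engine 1 cypari2 jobs j077792/j077793; engine 2 stdlib).
[cite: Miller2011LMS, Thm. 5.2 and Def. 1.1] [cite: Cremona2006, Table 1 (Cremona label 353440i1)] -/
theorem bsdp_c353440i1 (hCha : thm52_padicValNat_shaOrder_le)
    (hGZK : rank_eq_analyticRank_of_analyticRank_le_one)
    (W : WeierstrassCurve ℚ) (hW : W = ⟨0, 0, 0, -28136033, -57443604732⟩)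
    {N : ℕ} [NeZero N] {K : Type} [Field K] [NumberField K] (hK : IsImaginaryQuadratic K)
    (hH : SatisfiesHeegnerHypothesis N K) {P : (W.baseChange K).toAffine.Point}
    (hP : IsHeegnerPoint N W K P) (hnt : ¬ IsOfFinAddOrder P)
    (hpD : ¬ (5 : ℤ) ∣ NumberField.discr K) (hpN : ¬ 5 ^ 2 ∣ N)
    (hI : ¬ 5 ∣ (AddSubgroup.zmultiples P).index)
    (hr : W.analyticRank ≤ 1) {q : ℚ} (hq : shaAn W = (q : ℂ)) (hv : padicValRat 5 q = 0) :
    BSDp W 5 := by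
  subst hW
  haveI := isElliptic_of_discOf_ne_zero 0 0 0 (-28136033) (-57443604732) (by decide +kernel)
  haveI := isGloballyMinimal_of_krausCriterion_bounded₂ 0 0 0 (-28136033) (-57443604732) (by decide +kernel) (by decide +kernel)
    (by decide +kernel)
  haveI : Fact (Nat.Prime 5) := ⟨by norm_num⟩
  haveI : Fact (Nat.Prime 3) := ⟨by norm_num⟩
  exact bsdp_of_ainvs_of_chaCertificate hCha hGZK 0 0 0 (-28136033) (-57443604732) (integralModelInt_eq_of_map_eq _ (map_mk_int _ _ _ _ _))
    5 3 4 (by decide) (by decide +kernel) (by decide +kernel) (by decide) (by decide +kernel) card_c353440i1_3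
    (by decide +kernel) hK hH hP hnt (mod_cast hpD) hpN hI hr hq hv

/-- **`BSD(E,5)` for `389205h1`** (`N = 389205 = 3^4·5·31^2`; `ρ̄_{E,5}` image `5S4`, `nonsplit` multiplicative at `5`, additive at
`3`, `31`, `∏ c_q = 1`) from Cha 2005 + GZK and the Heegner-index certificate. Kernel: `Δ ≠ 0`, global
minimality (§2 of `ChaPairsMinimality`), `5 ∣ Δ ∧ 5 ∤ c₄`, `E[5]` irreducible (`ℓ = 7`, `#Ẽ(𝔽_7) = 8`,
`a_7 = 0`). Numbers (binders): `r_an ≤ 1`, `#Ш_an` a `5`-adic unit, the Heegner datum with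
`5 ∤ [E(K) : ℤ y_K]` — two-engine certificate of unit `b2b-bsdres-x11c` gen 3: `K = ℚ(√-11)`,
`m = √(4ρ) = 8`, `ord₅ m = 0` (engine 1 cypari2 jobs j077792/j077793; engine 2 stdlib).
[cite: Miller2011LMS, Thm. 5.2 and Def. 1.1] [cite: Cremona2006, Table 1 (Cremona label 389205h1)] -/
theorem bsdp_c389205h1 (hCha : thm52_padicValNat_shaOrder_le)
    (hGZK : rank_eq_analyticRank_of_analyticRank_le_one)
    (W : WeierstrassCurve ℚ) (hW : W = ⟨0, 0, 1, -19304568, -32596366336⟩)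
    {N : ℕ} [NeZero N] {K : Type} [Field K] [NumberField K] (hK : IsImaginaryQuadratic K)
    (hH : SatisfiesHeegnerHypothesis N K) {P : (W.baseChange K).toAffine.Point}
    (hP : IsHeegnerPoint N W K P) (hnt : ¬ IsOfFinAddOrder P)
    (hpD : ¬ (5 : ℤ) ∣ NumberField.discr K) (hpN : ¬ 5 ^ 2 ∣ N)
    (hI : ¬ 5 ∣ (AddSubgroup.zmultiples P).index)
    (hr : W.analyticRank ≤ 1) {q : ℚ} (hq : shaAn W = (q : ℂ)) (hv : padicValRat 5 q = 0) :
    BSDp W 5 := by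
  subst hW
  haveI := isElliptic_of_discOf_ne_zero 0 0 1 (-19304568) (-32596366336) (by decide +kernel)
  haveI := isGloballyMinimal_of_krausCriterion_bounded₂ 0 0 1 (-19304568) (-32596366336) (by decide +kernel) (by decide +kernel)
    (by decide +kernel)
  haveI : Fact (Nat.Prime 5) := ⟨by norm_num⟩
  haveI : Fact (Nat.Prime 7) := ⟨by norm_num⟩
  exact bsdp_of_ainvs_of_chaCertificate hCha hGZK 0 0 1 (-19304568) (-32596366336) (integralModelInt_eq_of_map_eq _ (map_mk_int _ _ _ _ _))
    5 7 8 (by decide) (by decide +kernel) (by decide +kernel) (by decide) (by decide +kernel) card_c389205h1_7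
    (by decide +kernel) hK hH hP hnt (mod_cast hpD) hpN hI hr hq hv

/-- **`BSD(E,5)` for `392040q1`** (`N = 392040 = 2^3·3^4·5·11^2`; `ρ̄_{E,5}` image `5S4`, `nonsplit` multiplicative at `5`, additive at
`2`, `3`, `11`, `∏ c_q = 2`) from Cha 2005 + GZK and the Heegner-index certificate. Kernel: `Δ ≠ 0`, global
minimality (§2 of `ChaPairsMinimality`), `5 ∣ Δ ∧ 5 ∤ c₄`, `E[5]` irreducible (`ℓ = 7`, `#Ẽ(𝔽_7) = 8`,
`a_7 = 0`). Numbers (binders): `r_an ≤ 1`, `#Ш_an` a `5`-adic unit, the Heegner datum with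
`5 ∤ [E(K) : ℤ y_K]` — two-engine certificate of unit `b2b-bsdres-x11c` gen 3: `K = ℚ(√-239)`,
`m = √(4ρ) = 8`, `ord₅ m = 0` (engine 1 cypari2 jobs j077792/j077793; engine 2 stdlib).
[cite: Miller2011LMS, Thm. 5.2 and Def. 1.1] [cite: Cremona2006, Table 1 (Cremona label 392040q1)] -/
theorem bsdp_c392040q1 (hCha : thm52_padicValNat_shaOrder_le)
    (hGZK : rank_eq_analyticRank_of_analyticRank_le_one)
    (W : WeierstrassCurve ℚ) (hW : W = ⟨0, 0, 0, -114708, 14944468⟩)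
    {N : ℕ} [NeZero N] {K : Type} [Field K] [NumberField K] (hK : IsImaginaryQuadratic K)
    (hH : SatisfiesHeegnerHypothesis N K) {P : (W.baseChange K).toAffine.Point}
    (hP : IsHeegnerPoint N W K P) (hnt : ¬ IsOfFinAddOrder P)
    (hpD : ¬ (5 : ℤ) ∣ NumberField.discr K) (hpN : ¬ 5 ^ 2 ∣ N)
    (hI : ¬ 5 ∣ (AddSubgroup.zmultiples P).index)
    (hr : W.analyticRank ≤ 1) {q : ℚ} (hq : shaAn W = (q : ℂ)) (hv : padicValRat 5 q = 0) :
    BSDp W 5 := by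
  subst hW
  haveI := isElliptic_of_discOf_ne_zero 0 0 0 (-114708) 14944468 (by decide +kernel)
  haveI := isGloballyMinimal_of_krausCriterion_bounded₂ 0 0 0 (-114708) 14944468 (by decide +kernel) (by decide +kernel)
    (by decide +kernel)
  haveI : Fact (Nat.Prime 5) := ⟨by norm_num⟩
  haveI : Fact (Nat.Prime 7) := ⟨by norm_num⟩
  exact bsdp_of_ainvs_of_chaCertificate hCha hGZK 0 0 0 (-114708) 14944468 (integralModelInt_eq_of_map_eq _ (map_mk_int _ _ _ _ _))
    5 7 8 (by decide) (by decide +kernel) (by decide +kernel) (by decide) (by decide +kernel) card_c392040q1_7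
    (by decide +kernel) hK hH hP hnt (mod_cast hpD) hpN hI hr hq hv

end Summit.BirchSwinnertonDyer.Rank1Residual.X11b

end
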